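import Summits.ValiantsHypothesis.ValiantsHypothesis.Theorems.BarrierLeverChowBenchmarkPairsPeel

/-!
# Route BarrierLever — item 22038 `ChowBenchmarkPairs`, line `moore-peel`: the PEELING LEMMA with a GENERIC new point
# over any characteristic-zero domain (the form needed to iterate symbolically)

Helper file (`--supports stmt-ValiantsHypothesis-22038`; cell valiant-natproofs, rung V4; seat val-np-p4 gen 21).  Closes NO item.

`…ChowBenchmarkPairsPeel.lean` proves the rigid extension lemma over `ℂ` with the SPARSE new point `x·𝟙_A`.  To iterate it
one needs the old points generic (the Vandermonde hypothesis dies at sparse points), i.e. a version (i) over an arbitrary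
characteristic-zero domain `R` (to take `R = MvPolynomial σ ℂ`, the generic table) and (ii) with the new point
`q + x·𝟙_A` for an ARBITRARY `q : κ → R` (the generic new point, its `A`-coordinates shifted by the peeling scalar `x`).
This file proves exactly that:

* `coeff_prod_shift` / `natDegree_prod_shift_le` — `∏_{c∈T} (q_c + x[c∈A])` has `x`-degree `≤ |A|` and
  `x^{|A|}`-coefficient `[A ⊆ T]·∏_{c∈T∖A} q_c` (split `T = (T∩A) ⊔ (T∖A)`, a monic product times a constant).
* rows `{new}`, `{a,new}` of the table `P ⊔ {q + X·𝟙_A}` (`symbTableQ`): degree `≤ |A|`, top coefficients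
  `[A ⊆ T]·|T|!·q^{T∖A}` (`coeff_newQ_single`) and `[A ⊆ T]·starZ P a q A T` (`coeff_newQ_pair`), where
  `starZ P a q A T = Σ_{d ⊆ T∖A} |d|!·|T∖d|!·P_a^d·q^{(T∖d)∖A}` (= the entry of the pair row `{a, q̃}` at `T∖A` for the
  MODIFIED point `q̃` with weights `(|A|+|D|)!`).
* `det_symbMatrixQ_ne_zero`: if `A` lies in no old column, every new column `U j` contains `A`, the old matrix is nonsingular and
  the block `zEntry` (row `{new}`: `|U_j|!·q^{U_j∖A}`; row `{a,new}`: `starZ P a q A (U j)`) is nonsingular, then the symbolic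
  determinant is a nonzero polynomial in `x`; `rigid_extensionQ_finite` / `rigid_extensionQ`: cofinitely many / some `x` work.
  For `q = 0` off `A` the block `zEntry` is `|A|!`·(the Vandermonde block of `…Peel.lean`); when `{U_j ∖ A}` is a down-set it is
  that Vandermonde block times a unitriangular matrix (not formalised here).

WHAT THIS IS NOT: no stub of the line is closed; nothing on crux stmt-ValiantsHypothesis-14610 or on `VP` versus `VNP`.
-/

set_option linter.dupNamespace false

namespace Summit.ValiantsHypothesis.ValiantsHypothesis.Theorems.BarrierLever.ChowBenchmarkPeel

open Finset Polynomial

variable {κ : Type*} [DecidableEq κ]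
variable {R : Type*} [CommRing R] {n : ℕ}

/-! ## 1. The shifted product `∏_{c∈T} (q_c + x·[c ∈ A])` -/

/-- `∏_{c∈T} (C (q c) + 𝟙_A(c)·X) = C (∏_{c ∈ T∖A} q c) · ∏_{c ∈ T ∩ A} (X + C (q c))`. -/
theorem prod_shift_eq (q : κ → R) (A T : Finset κ) :
    (∏ c ∈ T, (C (q c) + indPt A (X : R[X]) c)) =
      C (∏ c ∈ T \ A, q c) * ∏ c ∈ T ∩ A, (X + C (q c)) := by
  unfold indPt
  rw [← Finset.prod_filter_mul_prod_filter_not T (fun c => c ∈ A), mul_comm]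
  congr 1
  · rw [map_prod]
    refine (Finset.prod_congr ?_ fun c hc => ?_)
    · ext c; simp [Finset.mem_sdiff]
    · rw [Finset.mem_sdiff] at hc
      rw [if_neg hc.2, add_zero]
  · refine Finset.prod_congr ?_ fun c hc => ?_
    · ext c; simp [Finset.mem_inter]
    · rw [Finset.mem_inter] at hc
      rw [if_pos hc.2, add_comm]

/-- The shifted product has `x`-degree `≤ |A|`. -/
theorem natDegree_prod_shift_le (q : κ → R) (A T : Finset κ) :
    (∏ c ∈ T, (C (q c) + indPt A (X : R[X]) c)).natDegree ≤ A.card := by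
  rw [prod_shift_eq]
  refine (natDegree_C_mul_le _ _).trans ?_
  have hm : ∀ c ∈ T ∩ A, (X + C (q c) : R[X]).Monic := fun c _ => monic_X_add_C _
  rw [natDegree_prod_of_monic _ _ hm]
  calc ∑ c ∈ T ∩ A, (X + C (q c) : R[X]).natDegree ≤ ∑ _c ∈ T ∩ A, 1 :=
        Finset.sum_le_sum fun c _ => (natDegree_add_le _ _).trans (max_le natDegree_X_le (by simp))
    _ = (T ∩ A).card := by simp
    _ ≤ A.card := Finset.card_le_card Finset.inter_subset_right

/-- The `x^{|A|}`-coefficient of the shifted product is `[A ⊆ T]·∏_{c∈T∖A} q c`. -/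
theorem coeff_prod_shift [Nontrivial R] (q : κ → R) (A T : Finset κ) :
    (∏ c ∈ T, (C (q c) + indPt A (X : R[X]) c)).coeff A.card =
      if A ⊆ T then ∏ c ∈ T \ A, q c else 0 := by
  rw [prod_shift_eq, coeff_C_mul]
  have hm : ∀ c ∈ T ∩ A, (X + C (q c) : R[X]).Monic := fun c _ => monic_X_add_C _
  have hmon : (∏ c ∈ T ∩ A, (X + C (q c) : R[X])).Monic := monic_prod_of_monic _ _ hm
  have hdeg : (∏ c ∈ T ∩ A, (X + C (q c) : R[X])).natDegree = (T ∩ A).card := by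
    rw [natDegree_prod_of_monic _ _ hm]
    simp
  by_cases hA : A ⊆ T
  · rw [if_pos hA]
    have : T ∩ A = A := Finset.inter_eq_right.mpr hA
    rw [this] at hdeg hmon
    rw [this, ← hdeg, hmon.coeff_natDegree, mul_one]
  · rw [if_neg hA]
    have hlt : (T ∩ A).card < A.card := by
      refine Finset.card_lt_card (Finset.ssubset_iff_subset_ne.mpr ⟨Finset.inter_subset_right, fun e => hA ?_⟩)
      rw [← e]; exact Finset.inter_subset_left
    rw [coeff_eq_zero_of_natDegree_lt (by rw [hdeg]; exact hlt), mul_zero]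

/-! ## 2. The enlarged table with the generic new point `q + X·𝟙_A` -/

/-- The symbolic enlarged table: old points constant, new point `q + X·𝟙_A`. -/
noncomputable def symbTableQ (P : Fin n → κ → R) (q : κ → R) (A : Finset κ) : Option (Fin n) → κ → R[X] :=
  adjoin (constTable P) (fun c => C (q c) + indPt A X c)

/-- The «star entry» `Σ_{d ⊆ T∖A} |d|!·|T∖d|!·P_a^d·q^{(T∖d)∖A}`: the top coefficient of the row `{a, new}`. -/
def starZ (P : Fin n → κ → R) (a : Fin n) (q : κ → R) (A T : Finset κ) : R :=
  ∑ d ∈ (T \ A).powerset, (d.card.factorial : R) * ((T \ d).card.factorial : R) *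
    (∏ c ∈ d, P a c) * ∏ c ∈ (T \ d) \ A, q c

/-- The row `{new}` has `X`-degree `≤ |A|`. -/
theorem natDegree_newQ_single_le (P : Fin n → κ → R) (q : κ → R) (A T : Finset κ) :
    (segE (symbTableQ P q A) {none} T).natDegree ≤ A.card := by
  rw [symbTableQ, segE_singleton, adjoin_none, ← map_natCast C]
  exact (natDegree_C_mul_le _ _).trans (natDegree_prod_shift_le q A T)

/-- The `X^{|A|}`-coefficient of the row `{new}` is `[A ⊆ T]·|T|!·q^{T∖A}`. -/
theorem coeff_newQ_single [Nontrivial R] (P : Fin n → κ → R) (q : κ → R) (A T : Finset κ) :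
    (segE (symbTableQ P q A) {none} T).coeff A.card =
      if A ⊆ T then (T.card.factorial : R) * ∏ c ∈ T \ A, q c else 0 := by
  rw [symbTableQ, segE_singleton, adjoin_none, ← map_natCast C, coeff_C_mul, coeff_prod_shift]
  split_ifs <;> simp

/-- The row `{a, new}` has `X`-degree `≤ |A|`. -/
theorem natDegree_newQ_pair_le (P : Fin n → κ → R) (q : κ → R) (A : Finset κ) (a : Fin n) (T : Finset κ) :
    (segE (symbTableQ P q A) {some a, none} T).natDegree ≤ A.card := by
  rw [symbTableQ, segE_pair _ _ _ (Option.some_ne_none a)]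
  refine natDegree_sum_le_of_forall_le _ _ fun d _ => ?_
  simp only [constTable, adjoin_some, adjoin_none]
  rw [← map_natCast C, ← map_natCast C, ← map_prod C, ← map_mul, ← mul_assoc, ← map_mul]
  exact (natDegree_C_mul_le _ _).trans (natDegree_prod_shift_le q A _)

/-- The `X^{|A|}`-coefficient of the row `{a, new}` is `[A ⊆ T]·starZ P a q A T`. -/
theorem coeff_newQ_pair [Nontrivial R] (P : Fin n → κ → R) (q : κ → R) (A : Finset κ) (a : Fin n) (T : Finset κ) :
    (segE (symbTableQ P q A) {some a, none} T).coeff A.card = if A ⊆ T then starZ P a q A T else 0 := by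
  rw [symbTableQ, segE_pair _ _ _ (Option.some_ne_none a), finsetSum_coeff]
  have hterm : ∀ d ∈ T.powerset,
      ((d.card.factorial : R[X]) * ((T \ d).card.factorial : R[X]) *
        ((∏ c ∈ d, adjoin (constTable P) (fun c => C (q c) + indPt A X c) (some a) c) *
          ∏ c ∈ T \ d, adjoin (constTable P) (fun c => C (q c) + indPt A X c) none c)).coeff A.card =
        if A ⊆ T \ d then (d.card.factorial : R) * ((T \ d).card.factorial : R) *
          (∏ c ∈ d, P a c) * ∏ c ∈ (T \ d) \ A, q c else 0 := by
    intro d _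
    simp only [constTable, adjoin_some, adjoin_none]
    rw [← map_natCast C, ← map_natCast C, ← map_prod C, ← map_mul, ← mul_assoc, ← map_mul, coeff_C_mul,
      coeff_prod_shift]
    split_ifs <;> simp [mul_assoc]
  rw [Finset.sum_congr rfl hterm, ← Finset.sum_filter]
  have hfilt : T.powerset.filter (fun d => A ⊆ T \ d) = if A ⊆ T then (T \ A).powerset else ∅ := by
    ext d
    rw [Finset.mem_filter, Finset.mem_powerset]
    split_ifs with hA
    · rw [Finset.mem_powerset]
      constructor
      · rintro ⟨hdT, hAd⟩ c hc
        rw [Finset.mem_sdiff]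
        exact ⟨hdT hc, fun hcA => (Finset.mem_sdiff.mp (hAd hcA)).2 hc⟩
      · intro hd
        refine ⟨fun c hc => (Finset.mem_sdiff.mp (hd hc)).1, fun c hcA => ?_⟩
        rw [Finset.mem_sdiff]
        exact ⟨hA hcA, fun hcd => (Finset.mem_sdiff.mp (hd hcd)).2 hcA⟩
    · simp only [Finset.notMem_empty, iff_false, not_and]
      intro _ hAd
      exact hA (hAd.trans Finset.sdiff_subset)
  rw [hfilt]
  split_ifs with hA
  · rfl
  · rw [Finset.sum_empty]

/-- Old rows of the symbolic table are constants. -/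
theorem segE_symbTableQ_old (P : Fin n → κ → R) (q : κ → R) (A : Finset κ) (S : Finset (Fin n)) (T : Finset κ) :
    segE (symbTableQ P q A) (S.map Function.Embedding.some) T = C (segE P S T) := by
  rw [symbTableQ, segE_adjoin_map]
  exact (map_segE C P S T).symm


/-! ## 3. The peeling lemma with a generic new point over a characteristic-zero domain -/

section MainQ

variable {R : Type*} [CommRing R] [IsDomain R] [CharZero R] {n : ℕ}

/-- The block of top coefficients of the new rows: row `{new}` ↦ `|T|!·q^{T∖A}`, row `{a,new}` ↦ `starZ P a q A T`. -/
def zEntry (P : Fin n → κ → R) (q : κ → R) (A : Finset κ) : Option (Fin n) → Finset κ → R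
  | none, T => (T.card.factorial : R) * ∏ c ∈ T \ A, q c
  | some a, T => starZ P a q A T

/-- The symbolic segment-moment matrix of `P ⊔ {q + X·𝟙_A}` on the columns `T ⊔ U`, over `R[X]`. -/
noncomputable def symbMatrixQ (P : Fin n → κ → R) (q : κ → R) (T : Row n → Finset κ)
    (U : Option (Fin n) → Finset κ) (A : Finset κ) : Matrix (Row n ⊕ Option (Fin n)) (Row n ⊕ Option (Fin n)) R[X] :=
  Matrix.of fun i j => segE (symbTableQ P q A) (rowSet i) (Sum.elim T U j)

omit [IsDomain R] [CharZero R] in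
/-- Evaluating at `x` gives the segment-moment matrix of the table `P ⊔ {q + x·𝟙_A}`. -/
theorem eval_det_symbMatrixQ (P : Fin n → κ → R) (q : κ → R) (T : Row n → Finset κ)
    (U : Option (Fin n) → Finset κ) (A : Finset κ) (x : R) :
    (symbMatrixQ P q T U A).det.eval x = (Matrix.of fun i j : Row n ⊕ Option (Fin n) =>
      segE (adjoin P (fun c => q c + indPt A x c)) (rowSet i) (Sum.elim T U j)).det := by
  classical
  have h1 : (Polynomial.evalRingHom x) (symbMatrixQ P q T U A).det =
      ((Polynomial.evalRingHom x).mapMatrix (symbMatrixQ P q T U A)).det :=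
    RingHom.map_det _ _
  rw [Polynomial.coe_evalRingHom] at h1
  rw [h1]
  congr 1
  ext i j
  rw [RingHom.mapMatrix_apply, Matrix.map_apply, symbMatrixQ, Matrix.of_apply, Matrix.of_apply,
    Polynomial.coe_evalRingHom, ← Polynomial.coe_evalRingHom, map_segE]
  congr 1
  funext o c
  cases o with
  | none =>
    simp only [symbTableQ, adjoin_none, indPt, Polynomial.coe_evalRingHom]
    split_ifs <;> simp
  | some a => simp [symbTableQ, constTable]

/-- **The symbolic determinant is a nonzero polynomial (generic new point, characteristic-zero domain).**  Hypotheses: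
`A` lies in no old column; every new column contains `A`; the old matrix is nonsingular; the block `zEntry` of top
coefficients of the new rows at the new columns is nonsingular. -/
theorem det_symbMatrixQ_ne_zero (P : Fin n → κ → R) (q : κ → R) (T : Row n → Finset κ)
    (U : Option (Fin n) → Finset κ) (A : Finset κ) (hA : ∀ S, ¬ A ⊆ T S) (hU : ∀ j, A ⊆ U j)
    (hold : (Matrix.of fun S S' : Row n => segE P S.1 (T S')).det ≠ 0)
    (hZ : (Matrix.of fun i j : Option (Fin n) => zEntry P q A i (U j)).det ≠ 0) :
    (symbMatrixQ P q T U A).det ≠ 0 := by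
  classical
  set MX := symbMatrixQ P q T U A with hMX0
  have hMX : MX = Matrix.of fun i j => segE (symbTableQ P q A) (rowSet i) (Sum.elim T U j) := rfl
  set w : Row n ⊕ Option (Fin n) → R[X] := Sum.elim (fun _ => X ^ A.card) (fun _ => 1) with hw
  set MX' : Matrix (Row n ⊕ Option (Fin n)) (Row n ⊕ Option (Fin n)) R[X] :=
    Matrix.of fun i j => w i * MX i j with hMX'
  have hdet' : MX'.det = (∏ i, w i) * MX.det := Matrix.det_mul_column w MX
  suffices hne' : MX'.det ≠ 0 by
    intro h0; apply hne'; rw [hdet', h0, mul_zero]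
  have hdeg : ∀ i j, (MX' i j).natDegree ≤ A.card := by
    intro i j
    rw [hMX', Matrix.of_apply, hMX, Matrix.of_apply]
    cases i with
    | inl S =>
      rw [hw, Sum.elim_inl, rowSet, segE_symbTableQ_old, mul_comm]
      exact natDegree_C_mul_X_pow_le _ _
    | inr o =>
      rw [hw, Sum.elim_inr, one_mul]
      cases o with
      | none => exact natDegree_newQ_single_le P q A _
      | some a => exact natDegree_newQ_pair_le P q A a _
  have htop : (Matrix.of fun i j => (MX' i j).coeff A.card) =
      Matrix.fromBlocks (Matrix.of fun S S' : Row n => segE P S.1 (T S'))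
        (Matrix.of fun (S : Row n) (j : Option (Fin n)) => segE P S.1 (U j))
        0 (Matrix.of fun i j : Option (Fin n) => zEntry P q A i (U j)) := by
    ext i j
    rcases i with S | o <;> rcases j with S' | j'
    · rw [Matrix.of_apply, Matrix.fromBlocks_apply₁₁, Matrix.of_apply, hMX', Matrix.of_apply, hMX, Matrix.of_apply,
        hw, Sum.elim_inl, Sum.elim_inl, rowSet, segE_symbTableQ_old, mul_comm, coeff_C_mul_X_pow, if_pos rfl]
    · rw [Matrix.of_apply, Matrix.fromBlocks_apply₁₂, Matrix.of_apply, hMX', Matrix.of_apply, hMX, Matrix.of_apply,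
        hw, Sum.elim_inl, Sum.elim_inr, rowSet, segE_symbTableQ_old, mul_comm, coeff_C_mul_X_pow, if_pos rfl]
    · rw [Matrix.of_apply, Matrix.fromBlocks_apply₂₁, Matrix.zero_apply, hMX', Matrix.of_apply, hMX, Matrix.of_apply,
        hw, Sum.elim_inr, Sum.elim_inl, one_mul]
      cases o with
      | none => rw [rowSet, coeff_newQ_single, if_neg (hA S')]
      | some a => rw [rowSet, coeff_newQ_pair, if_neg (hA S')]
    · rw [Matrix.of_apply, Matrix.fromBlocks_apply₂₂, Matrix.of_apply, hMX', Matrix.of_apply, hMX, Matrix.of_apply,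
        hw, Sum.elim_inr, Sum.elim_inr, one_mul]
      cases o with
      | none => rw [rowSet, coeff_newQ_single, if_pos (hU j'), zEntry]
      | some a => rw [rowSet, coeff_newQ_pair, if_pos (hU j'), zEntry]
  have hcoeff : MX'.det.coeff (Fintype.card (Row n ⊕ Option (Fin n)) * A.card) ≠ 0 := by
    rw [coeff_det_of_natDegree_le MX' A.card hdeg, htop, Matrix.det_fromBlocks_zero₂₁]
    exact mul_ne_zero hold hZ
  intro h0
  rw [h0, coeff_zero] at hcoeff
  exact hcoeff rfl

/-- **Peeling lemma, generic new point, cofinite form**: all but finitely many `x` make `P ⊔ {q + x·𝟙_A}` nonsingular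
on `T ⊔ U`. -/
theorem rigid_extensionQ_finite (P : Fin n → κ → R) (q : κ → R) (T : Row n → Finset κ)
    (U : Option (Fin n) → Finset κ) (A : Finset κ) (hA : ∀ S, ¬ A ⊆ T S) (hU : ∀ j, A ⊆ U j)
    (hold : (Matrix.of fun S S' : Row n => segE P S.1 (T S')).det ≠ 0)
    (hZ : (Matrix.of fun i j : Option (Fin n) => zEntry P q A i (U j)).det ≠ 0) :
    Set.Finite {x : R | (Matrix.of fun i j : Row n ⊕ Option (Fin n) =>
      segE (adjoin P (fun c => q c + indPt A x c)) (rowSet i) (Sum.elim T U j)).det = 0} := by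
  have hne := det_symbMatrixQ_ne_zero P q T U A hA hU hold hZ
  refine (Polynomial.finite_setOf_isRoot hne).subset fun x hx => ?_
  rw [Set.mem_setOf_eq, Polynomial.IsRoot.def, eval_det_symbMatrixQ]
  exact hx

/-- **Peeling lemma, generic new point**: some `x` makes `P ⊔ {q + x·𝟙_A}` nonsingular on `T ⊔ U`. -/
theorem rigid_extensionQ (P : Fin n → κ → R) (q : κ → R) (T : Row n → Finset κ)
    (U : Option (Fin n) → Finset κ) (A : Finset κ) (hA : ∀ S, ¬ A ⊆ T S) (hU : ∀ j, A ⊆ U j)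
    (hold : (Matrix.of fun S S' : Row n => segE P S.1 (T S')).det ≠ 0)
    (hZ : (Matrix.of fun i j : Option (Fin n) => zEntry P q A i (U j)).det ≠ 0) :
    ∃ x : R, (Matrix.of fun i j : Row n ⊕ Option (Fin n) =>
      segE (adjoin P (fun c => q c + indPt A x c)) (rowSet i) (Sum.elim T U j)).det ≠ 0 := by
  have hfin := rigid_extensionQ_finite P q T U A hA hU hold hZ
  obtain ⟨x, hx⟩ := Set.Infinite.nonempty (Set.Finite.infinite_compl hfin)
  exact ⟨x, hx⟩

omit [IsDomain R] [CharZero R] in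
/-- Sanity link with the sparse version (`q = 0`): the pair-row top coefficient is `|T∖A|!·|A|!·P_a^{T∖A}`, i.e.
`|A|!` times the Vandermonde entry of `…Peel.lean`. -/
theorem zEntry_zero (P : Fin n → κ → R) (A T : Finset κ) (hAT : A ⊆ T) (a : Fin n) :
    zEntry P (fun _ => (0 : R)) A (some a) T =
      ((T \ A).card.factorial : R) * (A.card.factorial : R) * ∏ c ∈ T \ A, P a c := by
  rw [zEntry, starZ, Finset.sum_eq_single (T \ A)]
  · rw [Finset.sdiff_sdiff_eq_self hAT, Finset.sdiff_self, Finset.prod_empty, mul_one]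
  · intro d hd hne
    have hdT : d ⊆ T \ A := Finset.mem_powerset.mp hd
    have : ((T \ d) \ A).Nonempty := by
      have e : (T \ d) \ A = (T \ A) \ d := by
        ext c; simp only [Finset.mem_sdiff]; tauto
      rw [e]
      exact Finset.sdiff_nonempty.mpr (fun h => hne (Finset.Subset.antisymm hdT h))
    obtain ⟨c, hc⟩ := this
    rw [Finset.prod_eq_zero hc rfl, mul_zero]
  · intro h
    exact absurd (Finset.mem_powerset.mpr (Finset.Subset.refl _)) h

end MainQ

end Summit.ValiantsHypothesis.ValiantsHypothesis.Theorems.BarrierLever.ChowBenchmarkPeel
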